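import Summits.BirchSwinnertonDyer.BirchSwinnertonDyer.Theorems.CyclotomicUntwistPSTamagawaThreeLaw
import Summits.BirchSwinnertonDyer.BirchSwinnertonDyer.Theorems.CyclotomicUntwistPSTamagawaProduct
import Summits.BirchSwinnertonDyer.BirchSwinnertonDyer.Theorems.CyclotomicUntwistGNineConverse
import HarnessLib

/-!
# LAW L-c3 at the level of the Tamagawa PRODUCT: on the principal-series rows of route
# `CyclotomicUntwist`, `3 ∣ ∏ c_ℓ ⟺ (v₃Δ_min ≡ 2 (mod 4) ∧ c₆/3^{v₃c₆} ≡ 1 (mod 3)) ∨ 3 ∣ c_ℓ` at some `ℓ ≠ 3`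

Cell `pub/bsd-wall` (D-0145 line `route-BirchSwinnertonDyer-CyclotomicUntwist`), seat `bsd-line-cycu-p2`
(prover seat 2/3, gen 3), helper toward K1 `PSRankOneLowerHalfAtThree` (stmt-BirchSwinnertonDyer-21580) and
K2 `PSRankOneUpperHalfAtThree` (stmt-21581). THEOREMS ONLY (no definition, no named fact, no `sorry`); BSD
is not proved by this file and no crux is. It composes this seat's LAW L-c3
(`PSTamagawaThree.three_dvd_localTamagawaNumber_three_iff_of_psRow`, p601441: on the PS rows
`3 ∣ c₃ ⟺ v₃Δ_min ≡ 2 (mod 4) ∧ c₆/3^{v₃c₆} ≡ 1 (mod 3)`) with cycu-p4's localisation of the K1-stub-2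
predicate (`PSTamagawaProduct.three_dvd_tamagawaProduct_iff_of_even`, p597834: `3 ∣ ∏ c_v ⟺
(c₃ = 3 ∧ Kodaira IV/IV*) ∨ ∃ v ∤ 3, 3 ∣ c_v`) and with this base's `GNineCriterion` /
`GNineConverse` (on `ClassO6` rows `TypeGNine W ⟺ v₃Δ_min` even `∧ Δ_min/3^v ≡ 1 (mod 3)`), so that
the binder `¬ 3 ∣ W.tamagawaProduct` of the REGISTERED K1 stub `stub_rung_lowerHalfOnGNine_towerUnit`
(`ClassO6 W 3`, `TypeGNine W`) reads, at the prime `3`, as a congruence on the Kraus invariants: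

* `three_dvd_tamagawaProduct_iff_of_psRow` (binders `ClassO6`, `v` even, unit part `≡ 1`);
* `three_dvd_tamagawaProduct_iff_of_typeGNine` (binders `ClassO6`, `TypeGNine` — the K1-stub shape);
* the two pure cases: `three_dvd_tamagawaProduct_of_typeGNine_of_c₆` (`v ≡ 2 (4)` and `c₆/3^{v₃c₆} ≡ 1`
  force `3 ∣ ∏ c`: the rung `stub_rung_lowerHalfOnGNine_towerUnit` EXCLUDES these rows) and
  `three_dvd_tamagawaProduct_iff_away_of_typeGNine_of_c₆` (`c₆/3^{v₃c₆} ≢ 1`: `c₃ = 1`, the predicate lives at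
  `ℓ ≠ 3` only, as on the `η`-order-`3` rows of `PSTamagawaProduct.three_dvd_tamagawaProduct_iff_of_four_dvd`).

Census reading (cycu-p4 PS-KODAIRA-DICTIONARY-v2, EVIDENCE not used in the proofs): of the 416 onto PS rank-1
classes 72 have `4 ∣ v` (`c₃ = 1`), 344 have `v ≡ 2 (4)`, of which 305 have `c₃ = 3` — each now read off
`c₆ mod 3^{v₃c₆+1}` of the minimal model.

References: J. H. Silverman, *Advanced Topics in the Arithmetic of Elliptic Curves*, GTM 151 (1994), IV.9.4
[SilvermanATAEC1994]; *The Arithmetic of Elliptic Curves* (2009), Cor. VII.6.2 [SilvermanAEC2009]; A. Kraus,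
Manuscripta Math. 69 (1990) [Kraus1990].
-/

open scoped Classical NumberField

open IsDedekindDomain WeierstrassCurve Rat.HeightOneSpectrum
  Literature.NumberTheory.EllipticCurves Literature.NumberTheory.EllipticCurves.Rank1Residual
  Summit.BirchSwinnertonDyer.Rank1Residual.Additive

-- single-conjunct summit: `Summit.BirchSwinnertonDyer.BirchSwinnertonDyer.…` repeats the name by design
set_option linter.dupNamespace false
set_option autoImplicit false

namespace Summit.BirchSwinnertonDyer.BirchSwinnertonDyer.Theorems.PSTamagawaThree

variable (W : WeierstrassCurve ℚ) [W.IsElliptic] [W.IsGloballyMinimal]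

/-- **`3 ∣ ∏ c_ℓ` on the principal-series rows, in Kraus-invariant currency.** For `W` globally minimal on
the wild cell at `3` (`ClassO6 W 3`) with `v₃(Δ_min)` even and `Δ_min/3^v ≡ 1 (mod 3)`:
`3 ∣ W.tamagawaProduct ⟺ (v₃Δ_min % 4 = 2 ∧ c₆(W_ℤ)/3^{v₃c₆} % 3 = 1) ∨ ∃ v ∤ 3, 3 ∣ c_v`.
[cite: SilvermanATAEC1994, IV.9.4 Steps 3, 5, 8, 10] [cite: SilvermanAEC2009, Cor. VII.6.2] -/
theorem three_dvd_tamagawaProduct_iff_of_psRow (hO6 : ClassO6 W 3)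
    (hev : Even (padicValInt 3 W.minimalDiscriminantInt))
    (hsq : W.minimalDiscriminantInt / 3 ^ padicValInt 3 W.minimalDiscriminantInt % 3 = 1) :
    3 ∣ W.tamagawaProduct ↔
      (padicValInt 3 W.minimalDiscriminantInt % 4 = 2 ∧
        (integralModelInt W).c₆ / 3 ^ padicValInt 3 (integralModelInt W).c₆ % 3 = 1) ∨
      ∃ v : HeightOneSpectrum (𝓞 ℚ), (primesEquiv v : ℕ) ≠ 3 ∧
        3 ∣ (W.baseChange (v.adicCompletion ℚ)).localTamagawaNumber (v.adicCompletionIntegers ℚ) := by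
  have hO6' := hO6
  obtain ⟨-, hadd, hW⟩ := hO6'
  rw [PSTamagawaProduct.three_dvd_tamagawaProduct_iff_of_even W hadd hW hev,
    ← three_dvd_localTamagawaNumber_three_iff_of_psRow W hO6 hev hsq]
  refine or_congr_left ⟨fun h3 ↦ by rw [h3.1], fun h ↦ ⟨?_, ?_⟩⟩
  · rcases PSKodairaDictionary.localTamagawaNumber_three_of_even W hadd hW hev with h1 | h1
    · rw [h1] at h; exact absurd h (by decide)
    · exact h1
  · exact (PSKodairaDictionary.mod_four_eq_two_of_three_dvd_localTamagawaNumber W hadd hW hev h).2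

/-- **The same in the binder shape of the registered K1 stubs** (`ClassO6 W 3`, `TypeGNine W`): on the
`(G₉) ∩ (w)` rows `v₃(Δ_min)` is even (`GNineCriterion.subWCyclic_of_subW_of_typeGNine`) and
`Δ_min/3^v ≡ 1 (mod 3)` (`GNineConverse.mod_three_eq_one_of_typeGNine`), so
`3 ∣ W.tamagawaProduct ⟺ (v₃Δ_min % 4 = 2 ∧ c₆/3^{v₃c₆} % 3 = 1) ∨ ∃ v ∤ 3, 3 ∣ c_v`.
[cite: SilvermanATAEC1994, IV.9.4] [cite: Kraus1990, Théorème (p = 3)] -/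
theorem three_dvd_tamagawaProduct_iff_of_typeGNine (hO6 : ClassO6 W 3) (hG : TypeGNine W) :
    3 ∣ W.tamagawaProduct ↔
      (padicValInt 3 W.minimalDiscriminantInt % 4 = 2 ∧
        (integralModelInt W).c₆ / 3 ^ padicValInt 3 (integralModelInt W).c₆ % 3 = 1) ∨
      ∃ v : HeightOneSpectrum (𝓞 ℚ), (primesEquiv v : ℕ) ≠ 3 ∧
        3 ∣ (W.baseChange (v.adicCompletion ℚ)).localTamagawaNumber (v.adicCompletionIntegers ℚ) :=
  three_dvd_tamagawaProduct_iff_of_psRow W hO6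
    (GNineCriterion.subWCyclic_of_subW_of_typeGNine W hO6.2.2 hG).2
    (GNineConverse.mod_three_eq_one_of_typeGNine W hG hO6)

/-- **`c₃ = 3` rows are OUTSIDE the rung.** On a `(G₉) ∩ (w)` row with `v₃Δ_min ≡ 2 (mod 4)` and
`c₆/3^{v₃c₆} ≡ 1 (mod 3)` the Tamagawa product is divisible by `3` (through `c₃ = 3`), so the registered
rung `stub_rung_lowerHalfOnGNine_towerUnit` (`¬ 3 ∣ ∏ c`) does not contain it. [cite: SilvermanATAEC1994, IV.9.4 Steps 5, 8] -/
theorem three_dvd_tamagawaProduct_of_typeGNine_of_c₆ (hO6 : ClassO6 W 3) (hG : TypeGNine W)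
    (h2 : padicValInt 3 W.minimalDiscriminantInt % 4 = 2)
    (hc : (integralModelInt W).c₆ / 3 ^ padicValInt 3 (integralModelInt W).c₆ % 3 = 1) :
    3 ∣ W.tamagawaProduct :=
  (three_dvd_tamagawaProduct_iff_of_typeGNine W hO6 hG).mpr (Or.inl ⟨h2, hc⟩)

/-- **`c₃ = 1` rows: the rung predicate lives away from `3`.** On a `(G₉) ∩ (w)` row with
`c₆/3^{v₃c₆} ≢ 1 (mod 3)` (or `4 ∣ v₃Δ_min`, cycu-p4's `three_dvd_tamagawaProduct_iff_of_four_dvd`):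
`3 ∣ W.tamagawaProduct ⟺ 3 ∣ c_v` at some finite place `v ∤ 3`. [cite: SilvermanATAEC1994, IV.9.4] [cite: SilvermanAEC2009, Cor. VII.6.2] -/
theorem three_dvd_tamagawaProduct_iff_away_of_typeGNine_of_c₆ (hO6 : ClassO6 W 3) (hG : TypeGNine W)
    (hc : (integralModelInt W).c₆ / 3 ^ padicValInt 3 (integralModelInt W).c₆ % 3 ≠ 1) :
    3 ∣ W.tamagawaProduct ↔ ∃ v : HeightOneSpectrum (𝓞 ℚ), (primesEquiv v : ℕ) ≠ 3 ∧
      3 ∣ (W.baseChange (v.adicCompletion ℚ)).localTamagawaNumber (v.adicCompletionIntegers ℚ) := by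
  rw [three_dvd_tamagawaProduct_iff_of_typeGNine W hO6 hG]
  exact ⟨fun h ↦ h.resolve_left fun h' ↦ hc h'.2, Or.inr⟩

/-- **The Tamagawa factor at `3` itself, K1-stub binder shape**: on a `(G₉) ∩ (w)` row,
`c₃ = 3 ⟺ v₃Δ_min % 4 = 2 ∧ c₆/3^{v₃c₆} % 3 = 1`, and otherwise `c₃ = 1`.
[cite: SilvermanATAEC1994, IV.9.4 Steps 3, 5, 8, 10] -/
theorem localTamagawaNumber_three_eq_three_iff_of_typeGNine (hO6 : ClassO6 W 3) (hG : TypeGNine W) :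
    ((W.baseChange ℚ_[3]).localTamagawaNumber ℤ_[3] = 3 ↔
      padicValInt 3 W.minimalDiscriminantInt % 4 = 2 ∧
        (integralModelInt W).c₆ / 3 ^ padicValInt 3 (integralModelInt W).c₆ % 3 = 1) ∧
    ((W.baseChange ℚ_[3]).localTamagawaNumber ℤ_[3] = 1 ↔
      ¬ (padicValInt 3 W.minimalDiscriminantInt % 4 = 2 ∧
        (integralModelInt W).c₆ / 3 ^ padicValInt 3 (integralModelInt W).c₆ % 3 = 1)) := by
  have hev := (GNineCriterion.subWCyclic_of_subW_of_typeGNine W hO6.2.2 hG).2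
  have key := three_dvd_localTamagawaNumber_three_iff_of_psRow W hO6 hev
    (GNineConverse.mod_three_eq_one_of_typeGNine W hG hO6)
  rcases PSKodairaDictionary.localTamagawaNumber_three_of_even W hO6.2.1 hO6.2.2 hev with h1 | h3
  · rw [h1] at key ⊢
    have hn : ¬ ((3 : ℕ) ∣ 1) := by decide
    exact ⟨⟨fun h ↦ absurd h (by decide), fun h ↦ absurd (key.mpr h) hn⟩,
      ⟨fun _ h ↦ hn (key.mpr h), fun _ ↦ rfl⟩⟩
  · rw [h3] at key ⊢
    have hy : (3 : ℕ) ∣ 3 := dvd_refl 3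
    exact ⟨⟨fun _ ↦ key.mp hy, fun _ ↦ rfl⟩,
      ⟨fun h ↦ absurd h (by decide), fun h ↦ absurd (key.mp hy) h⟩⟩

end Summit.BirchSwinnertonDyer.BirchSwinnertonDyer.Theorems.PSTamagawaThree
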